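import Summits.CriticalPhenomena.PercolationContinuityZ3.Theorems.Transplant.FKConnectivityAllQCondClusterDom
import Summits.CriticalPhenomena.PercolationContinuityZ3.Theorems.Transplant.FKConnectivityAllQEdgeToggle
import Literature.Probability.Percolation.TwoSetConditionalAssociationRC
import Literature.Probability.Percolation.KozmaNitzanClusterPropertyReal
import Literature.Probability.Percolation.KozmaNitzanSeparatingTriple
import Literature.Probability.Percolation.TwoGhostSpace
import HarnessLib

/-!
# Connectivity correlation inequalities for `φ_{w,q}` — TOOLS for the `q ≥ 1` proofs of the conditional monotonicity nodes
# MMc⁺ / MMc⁻: the contraction identity for an arbitrary integrand, the cluster after opening one pair, one-cluster CPA and the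
# cluster Markov property at sum level, monotonicity of the world quantities

Support file (`--supports stmt-CriticalPhenomena-4575`), FK sub-lane `prim-bschramm-fk-1` (gen 9) of the post-continuity
programme; builds on p205010 (kernel theorem, internal audit signed; external expert review pending).  No definitions of
statements, no named facts, no sorries; standard axioms.  Consumed by `…CondClusterDomOneLe.lean` (the theorems
`condClusterDomAdjOn_of_one_le`, `crossClusterAntiAdjOn_of_one_le`).

CONTENTS.
* `sum_rcWeightW_update_one_eq_sum_insert`, `real_update_one_eq` — **contraction identity** for ANY integrand (fk-2 g6's
  `rcWeightW_update_one_insert` summed): `φ_{w[f↦1],q}(E) = κ·E_{φ_{w[f↦0],q}}[(1_{x↔y} + q⁻¹·1_{x↮y})·1_E(ω ∪ {f})]`, `f = s(x,y)`,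
  `κ = Z_{w[f↦0]}/Z_{w[f↦1]}` (Grimmett Thm (3.1)(a): opening `f` costs `q⁻¹` exactly when `x ↮ y`).
* `openCluster_insert_self` (`C_x(ω ∪ {xz}) = C_x ∪ C_z`, from the tree's `reachable_insert_iff`), `insert_mem_sepEv_self_iff`, `openCluster_insert_of_sep` (off `C_x ∪ C_z`
  nothing changes).
* `cpa_rcE` / `cpa_rcE_anti` — vdBHK Thm 2.1 ⇒ Thm 1.3 for `φ_{𝐩,q}`, `q ≥ 1` (tree theorem
  `BHK2006_clusterConditionalPositiveAssociation_rc`) at sum level: `E[F(C_s); s↮t]·E[G(C_s); s↮t] ≤ φ(s↮t)·E[FG; s↮t]` for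
  increasing `F, G` (reversed for `G` decreasing).
* `markov_rcE` — the cluster Markov property (vdBHK Lemma 2.3/2.4 for `φ_{𝐩,q}`, tree theorem `rc_set_sum_cond_cluster`) at sum
  level: on `{s ↮ t}`, `E[Φ(C_s)·1{C_t ∈ 𝒬}] = E[Φ(C_s)·φ_{G − B(C_s)}(C_t ∈ 𝒬)]`.
* `antitone_real_openConn_delW`, `monotone_real_sepEv_delW` — `C ↦ φ_{G − B(C)}(a ↔ b)` is decreasing in the cluster for `q ≥ 1`
  (comparison in `𝐩`, Grimmett Thm (3.21)).
[cite: VandenbergHaggstromKahn2005, Thm. 1.3 (p. 6); Thm. 2.1 (p. 9); Lemma 2.3/2.4 (p. 10)]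
[cite: Grimmett2006, Thm. (3.1)(a) (p. 37); Thm. (3.21) (p. 43); §1.4 eq. (1.20) (p. 15)]
-/

noncomputable section

namespace Summit.CriticalPhenomena.PercolationContinuityZ3.Theorems

namespace FK

open MeasureTheory Set Literature.Probability.LatticeModels Literature.Probability.Percolation
open Literature.Probability.Percolation.KNPreFKG
open scoped Classical symmDiff
open BHK2006 DecisionTree HullPort
open Literature.Probability.Percolation.TwoAvoidanceSets (ind_mul_ind)

variable {V : Type*} [Fintype V]

/-! ### Opening one pair: the contraction identity for an arbitrary integrand -/

/-- **Contraction identity** (any `q ≠ 0`): for `f = s(x,y)` and any integrand `G`,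
`Σ_ω w_q[f↦1](ω)·G(ω) = Σ_ω w_q[f↦0](ω)·(1 + (q⁻¹ − 1)·1{x ↮ y}(ω))·G(ω ∪ {f})` — substitute `ω ↦ ω ∆ {f}`; configurations
without `f` carry no `w[f↦1]`-weight, configurations with `f` no `w[f↦0]`-weight. [cite: Grimmett2006, Thm. (3.1)(a) (p. 37); §1.4 eq. (1.20) (p. 15)] -/
theorem sum_rcWeightW_update_one_eq_sum_insert (w : Sym2 V → unitInterval) {q : ℝ} (hq : q ≠ 0) (x y : V)
    (G : BondConfig V → ℝ) :
    ∑ ω : BondConfig V, rcWeightW (Function.update w s(x, y) 1) q ∅ ω * G ω =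
      ∑ ω : BondConfig V, rcWeightW (Function.update w s(x, y) 0) q ∅ ω *
        ((1 + (q⁻¹ - 1) * ind (openConn x y : Set (BondConfig V))ᶜ ω) * G (insert s(x, y) ω)) := by
  let σ : Equiv.Perm (BondConfig V) := Function.Involutive.toPerm (fun ω : BondConfig V => ω ∆ {s(x, y)})
    (symmDiff_left_involutive {s(x, y)})
  calc ∑ ω : BondConfig V, rcWeightW (Function.update w s(x, y) 1) q ∅ ω * G ω
      = ∑ ω : BondConfig V, rcWeightW (Function.update w s(x, y) 1) q ∅ (σ ω) * G (σ ω) :=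
        (Equiv.sum_comp σ (fun ω => rcWeightW (Function.update w s(x, y) 1) q ∅ ω * G ω)).symm
    _ = _ := by
        refine Finset.sum_congr rfl fun ω _ => ?_
        change rcWeightW (Function.update w s(x, y) 1) q ∅ (ω ∆ {s(x, y)}) * G (ω ∆ {s(x, y)}) = _
        by_cases heω : s(x, y) ∈ ω
        · have hnot : s(x, y) ∉ ω ∆ {s(x, y)} := by simp [Set.mem_symmDiff, heω]
          rw [rcWeightW_eq_zero_of_one_not_mem (Function.update w s(x, y) 1) q ∅ (by simp) hnot,
            rcWeightW_eq_zero_of_zero_mem (Function.update w s(x, y) 0) q ∅ (by simp) heω]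
          ring
        · have hins : ω ∆ {s(x, y)} = insert s(x, y) ω := by
            ext f
            simp only [Set.mem_symmDiff, Set.mem_singleton_iff, Set.mem_insert_iff]
            constructor
            · rintro (⟨hf, -⟩ | ⟨rfl, -⟩)
              · exact Or.inr hf
              · exact Or.inl rfl
            · rintro (rfl | hf)
              · exact Or.inr ⟨rfl, heω⟩
              · exact Or.inl ⟨hf, fun h => heω (h ▸ hf)⟩
          rw [hins, rcWeightW_update_one_insert w hq heω]
          ring

omit [Fintype V] in
/-- The factor `1 + (q⁻¹ − 1)·1{x ↮ y}` is `1` on `{x ↔ y}` and `q⁻¹` on `{x ↮ y}`: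
`1 + (q⁻¹ − 1)·1_{Dᶜ'} = 1_{x↔y} + q⁻¹·1_{x↮y}`. [folklore] -/
theorem toggle_factor_eq (q : ℝ) (x y : V) (ω : BondConfig V) :
    1 + (q⁻¹ - 1) * ind (openConn x y : Set (BondConfig V))ᶜ ω =
      ind (openConn x y : Set (BondConfig V)) ω + q⁻¹ * ind (openConn x y : Set (BondConfig V))ᶜ ω := by
  by_cases h : ω ∈ (openConn x y : Set (BondConfig V))
  · have hc : ω ∉ (openConn x y : Set (BondConfig V))ᶜ := fun h' => h' h
    rw [ind_of_mem h, ind_of_not_mem hc]; ring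
  · have hc : ω ∈ (openConn x y : Set (BondConfig V))ᶜ := h
    rw [ind_of_not_mem h, ind_of_mem hc]; ring

/-- **Normalised contraction identity**: `φ_{w[f↦1],q}(E) = κ · E_{φ_{w[f↦0],q}}[(1_{x↔y} + q⁻¹·1_{x↮y})·1_E(ω ∪ {f})]` with
`κ = Z_{w[f↦0]}/Z_{w[f↦1]} > 0`. [cite: Grimmett2006, Thm. (3.1)(a) (p. 37); §1.4 eq. (1.20) (p. 15)] -/
theorem real_update_one_eq (w : Sym2 V → unitInterval) {q : ℝ} (hq : 0 < q) (x y : V) (E : Set (BondConfig V)) :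
    (rcMeasureW (Function.update w s(x, y) 1) q ∅).real E =
      (rcPartitionFunctionW (Function.update w s(x, y) 0) q ∅ / rcPartitionFunctionW (Function.update w s(x, y) 1) q ∅) *
        rcE (Function.update w s(x, y) 0) q (fun ω =>
          (ind (openConn x y : Set (BondConfig V)) ω + q⁻¹ * ind (openConn x y : Set (BondConfig V))ᶜ ω) *
            ind E (insert s(x, y) ω)) := by
  have hZ0 := rcPartitionFunctionW_pos (Function.update w s(x, y) 0) hq ∅
  have hZ1 := rcPartitionFunctionW_pos (Function.update w s(x, y) 1) hq ∅
  rw [rcMeasureW_real_eq_sum_div _ hq, sum_rcWeightW_update_one_eq_sum_insert w hq.ne' x y (ind E)]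
  unfold rcE rcMass
  rw [Finset.mul_sum, Finset.sum_div]
  refine Finset.sum_congr rfl fun ω _ => ?_
  rw [toggle_factor_eq]
  field_simp

/-! ### The cluster after opening the pair `f = s(x,z)` -/

omit [Fintype V] in
/-- `C_x(ω ∪ {xz}) = C_x(ω) ∪ C_z(ω)`. [folklore] -/
theorem openCluster_insert_self (ω : BondConfig V) (x z : V) :
    openCluster (insert s(x, z) ω) x = openCluster ω x ∪ openCluster ω z := by
  ext v
  simp only [openCluster, mem_setOf_eq, mem_union]
  exact reachable_insert_iff ω x z v

omit [Fintype V] in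
/-- `{x ↮ c}(ω ∪ {xz}) ⟺ {x ↮ c}(ω) ∧ {z ↮ c}(ω)`. [folklore] -/
theorem insert_mem_sepEv_self_iff (ω : BondConfig V) (x z c : V) :
    insert s(x, z) ω ∈ sepEv x c ↔ ω ∈ sepEv x c ∧ ω ∈ sepEv z c := by
  simp only [mem_sepEv_iff, reachable_insert_iff, not_or]

omit [Fintype V] in
/-- Off the clusters of `x` and `z`, opening `s(x,z)` changes no connection: if `c ↮ x` and `c ↮ z` in `ω` then
`c ↔ v` in `ω ∪ {xz}` iff `c ↔ v` in `ω`. [folklore] -/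
theorem reachable_insert_iff_of_sep (ω : BondConfig V) {x z c : V} (hx : ¬ (openGraph ω).Reachable c x)
    (hz : ¬ (openGraph ω).Reachable c z) (v : V) :
    (openGraph (insert s(x, z) ω)).Reachable c v ↔ (openGraph ω).Reachable c v := by
  rw [KNSep.reachable_insert_iff ω x z c v]
  constructor
  · rintro (h | ⟨h, -⟩ | ⟨h, -⟩)
    · exact h
    · exact absurd h hx
    · exact absurd h hz
  · exact fun h => Or.inl h

omit [Fintype V] in
/-- Hence `C_c(ω ∪ {xz}) = C_c(ω)` when `c ↮ x`, `c ↮ z`. [folklore] -/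
theorem openCluster_insert_of_sep (ω : BondConfig V) {x z c : V} (hx : ¬ (openGraph ω).Reachable c x)
    (hz : ¬ (openGraph ω).Reachable c z) : openCluster (insert s(x, z) ω) c = openCluster ω c := by
  ext v
  simp only [openCluster, mem_setOf_eq]
  exact reachable_insert_iff_of_sep ω hx hz v

/-! ### Indicator bookkeeping -/

omit [Fintype V] in
/-- `1{C_s ∈ 𝒬}(ω) = 1_𝒬(C_s(ω))`. [folklore] -/
theorem ind_clusterIn (s : V) (𝒬 : Set (Set V)) (ω : BondConfig V) : ind (clusterIn s 𝒬) ω = ind 𝒬 (openCluster ω s) := rfl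

omit [Fintype V] in
/-- `1{C_s ∈ 𝒬}` read on the edge cluster of `s` through its vertex span. [cite: VandenbergHaggstromKahn2005, §1 p. 3] -/
theorem ind_span_openEdgeCluster (s : V) (𝒬 : Set (Set V)) (ω : BondConfig V) :
    ind 𝒬 {a | a = s ∨ ∃ e ∈ openEdgeCluster ω s, a ∈ e} = ind (clusterIn s 𝒬) ω := by
  rw [ind_clusterIn, ← openCluster_eq_setOf_openEdgeCluster]

omit [Fintype V] in
/-- For an up-set `𝒬`, `C ↦ 1_𝒬(span_s C)` is monotone in the edge cluster. [folklore] -/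
theorem monotone_ind_span (s : V) {𝒬 : Set (Set V)} (h𝒬 : IsUpperSet 𝒬) :
    Monotone fun C : Set (Sym2 V) => ind 𝒬 {a | a = s ∨ ∃ e ∈ C, a ∈ e} := by
  refine monotone_clusterFun s (ind 𝒬) fun S T hST => ?_
  by_cases hS : S ∈ 𝒬
  · rw [ind_of_mem hS, ind_of_mem (h𝒬 hST hS)]
  · rw [ind_of_not_mem hS]; exact ind_nonneg _ _

omit [Fintype V] in
/-- For a down-set `𝒬` (complement of an up-set), `C ↦ 1_𝒬(span_s C)` is antitone. [folklore] -/
theorem antitone_ind_span (s : V) {𝒬 : Set (Set V)} (h𝒬 : IsLowerSet 𝒬) :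
    Antitone fun C : Set (Sym2 V) => ind 𝒬 {a | a = s ∨ ∃ e ∈ C, a ∈ e} := by
  intro C C' hCC'
  have hsub : {a | a = s ∨ ∃ e ∈ C, a ∈ e} ⊆ {a | a = s ∨ ∃ e ∈ C', a ∈ e} := by
    rintro a (h | ⟨e, he, hae⟩)
    · exact Or.inl h
    · exact Or.inr ⟨e, hCC' he, hae⟩
  dsimp only
  by_cases hS : {a | a = s ∨ ∃ e ∈ C', a ∈ e} ∈ 𝒬
  · rw [ind_of_mem hS, ind_of_mem (h𝒬 hsub hS)]
  · rw [ind_of_not_mem hS]; exact ind_nonneg _ _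

omit [Fintype V] in
/-- `{C_s ∌ z}` is the separation event `{s ↮ z}`. [folklore] -/
theorem clusterIn_not_mem_eq_sepEv (s z : V) : clusterIn s {S : Set V | z ∉ S} = sepEv s z := rfl

omit [Fintype V] in
/-- `{s ↮ z}` is the complement of `{s ↔ z}`. [folklore] -/
theorem sepEv_eq_compl_openConn (s z : V) : (sepEv s z : Set (BondConfig V)) = (openConn s z)ᶜ := rfl

omit [Fintype V] in
/-- `{S | z ∉ S}` is a down-set. [folklore] -/
theorem isLowerSet_not_containing (z : V) : IsLowerSet {S : Set V | z ∉ S} := fun _ _ hTS hz hzT => hz (hTS hzT)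

/-- Linearity of `E_w`: additivity. [folklore] -/
theorem rcE_add_fun (w : Sym2 V → unitInterval) (q : ℝ) (g h : BondConfig V → ℝ) :
    rcE w q (fun ω => g ω + h ω) = rcE w q g + rcE w q h := by
  unfold rcE; rw [← Finset.sum_add_distrib]; exact Finset.sum_congr rfl fun ω _ => by ring

/-- Linearity of `E_w`: constants. [folklore] -/
theorem rcE_const_mul_fun (w : Sym2 V → unitInterval) (q : ℝ) (a : ℝ) (h : BondConfig V → ℝ) :
    rcE w q (fun ω => a * h ω) = a * rcE w q h := by
  unfold rcE; rw [Finset.mul_sum]; exact Finset.sum_congr rfl fun ω _ => by ring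

/-- Monotonicity of `E_w` in the integrand (`q > 0`). [folklore] -/
theorem rcE_mono_fun (w : Sym2 V → unitInterval) {q : ℝ} (hq : 0 < q) {g h : BondConfig V → ℝ} (hgh : ∀ ω, g ω ≤ h ω) :
    rcE w q g ≤ rcE w q h :=
  Finset.sum_le_sum fun ω _ => mul_le_mul_of_nonneg_left (hgh ω) (rcMass_nonneg w hq ω)

/-- `E_w` of a nonnegative integrand is nonnegative (`q > 0`). [folklore] -/
theorem rcE_nonneg_fun (w : Sym2 V → unitInterval) {q : ℝ} (hq : 0 < q) {h : BondConfig V → ℝ} (hh : ∀ ω, 0 ≤ h ω) :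
    0 ≤ rcE w q h :=
  Finset.sum_nonneg fun ω _ => mul_nonneg (rcMass_nonneg w hq ω) (hh ω)

/-- Splitting an event along `{x ↔ z}` / `{x ↮ z}`: `E[1_S] = E[1_{S ∩ {x↔z}}] + E[1_{S ∩ {x↮z}}]`. [folklore] -/
theorem rcE_ind_split (w : Sym2 V → unitInterval) (q : ℝ) (S : Set (BondConfig V)) (x z : V) :
    rcE w q (ind S) = rcE w q (ind (S ∩ openConn x z)) + rcE w q (ind (S ∩ sepEv x z)) := by
  rw [← rcE_add_fun]
  refine congrArg (rcE w q) (funext fun ω => ?_)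
  rw [ind_inter, ind_inter]
  by_cases h : ω ∈ (openConn x z : Set (BondConfig V))
  · have h' : ω ∉ sepEv x z := fun h' => h' h
    rw [ind_of_mem h, ind_of_not_mem h']; ring
  · have h' : ω ∈ sepEv x z := h
    rw [ind_of_not_mem h, ind_of_mem h']; ring

/-! ### The two inputs: one-cluster CPA (vdBHK Thm 2.1 ⇒ 1.3 for `φ_{𝐩,q}`, `q ≥ 1`) and the cluster Markov property -/

omit [Fintype V] in
/-- Set-builder form of `{s ↮ t}` used by the vdBHK theorems of the tree. [folklore] -/
theorem setOf_forall_mem_singleton_not_reachable (s t : V) :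
    {ω : BondConfig V | ∀ y ∈ ({t} : Set V), ¬ (openGraph ω).Reachable s y} = sepEv s t := by
  ext ω; simp only [mem_setOf_eq, mem_singleton_iff, forall_eq, mem_sepEv_iff]

/-- **One-cluster conditional positive association for `φ_{w,q}`, `q ≥ 1`, sum form**: for `F, G` increasing functions of the edge
cluster `C_s`, `E[F(C_s); s↮t]·E[G(C_s); s↮t] ≤ φ(s↮t)·E[F(C_s)G(C_s); s↮t]`.
[cite: VandenbergHaggstromKahn2005, Thm. 1.3 (p. 6); Thm. 2.1 (p. 9)] -/
theorem cpa_rcE (w : Sym2 V → unitInterval) {q : ℝ} (hq : 1 ≤ q) (s t : V) (F G : Set (Sym2 V) → ℝ)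
    (hF : Monotone F) (hG : Monotone G) :
    rcE w q (fun ω => F (openEdgeCluster ω s) * ind (sepEv s t) ω) *
        rcE w q (fun ω => G (openEdgeCluster ω s) * ind (sepEv s t) ω) ≤
      rcE w q (ind (sepEv s t)) *
        rcE w q (fun ω => F (openEdgeCluster ω s) * G (openEdgeCluster ω s) * ind (sepEv s t) ω) := by
  have hq0 : 0 < q := one_pos.trans_le hq
  have key := BHK2006_clusterConditionalPositiveAssociation_rc w hq s {t} F G hF hG
  rw [setOf_forall_mem_singleton_not_reachable, setIntegral_rcMeasureW_eq_sum w hq0,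
    setIntegral_rcMeasureW_eq_sum w hq0, setIntegral_rcMeasureW_eq_sum w hq0,
    rcMeasureW_real_eq_sum_rcMass w hq0] at key
  exact key

/-- The increasing/decreasing case: for `F` increasing and `G` decreasing, `φ(s↮t)·E[F G; s↮t] ≤ E[F; s↮t]·E[G; s↮t]`.
[cite: VandenbergHaggstromKahn2005, Thm. 1.3 (p. 6, last sentence); Thm. 2.1 (p. 9)] -/
theorem cpa_rcE_anti (w : Sym2 V → unitInterval) {q : ℝ} (hq : 1 ≤ q) (s t : V) (F G : Set (Sym2 V) → ℝ)
    (hF : Monotone F) (hG : Antitone G) :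
    rcE w q (ind (sepEv s t)) *
        rcE w q (fun ω => F (openEdgeCluster ω s) * G (openEdgeCluster ω s) * ind (sepEv s t) ω) ≤
      rcE w q (fun ω => F (openEdgeCluster ω s) * ind (sepEv s t) ω) *
        rcE w q (fun ω => G (openEdgeCluster ω s) * ind (sepEv s t) ω) := by
  have key := cpa_rcE w hq s t F (fun C => -G C) hF fun _ _ h => neg_le_neg (hG h)
  have e1 : rcE w q (fun ω => -G (openEdgeCluster ω s) * ind (sepEv s t) ω) =
      -rcE w q (fun ω => G (openEdgeCluster ω s) * ind (sepEv s t) ω) := by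
    unfold rcE; rw [← Finset.sum_neg_distrib]; exact Finset.sum_congr rfl fun ω _ => by ring
  have e2 : rcE w q (fun ω => F (openEdgeCluster ω s) * -G (openEdgeCluster ω s) * ind (sepEv s t) ω) =
      -rcE w q (fun ω => F (openEdgeCluster ω s) * G (openEdgeCluster ω s) * ind (sepEv s t) ω) := by
    unfold rcE; rw [← Finset.sum_neg_distrib]; exact Finset.sum_congr rfl fun ω _ => by ring
  rw [e1, e2, mul_neg, mul_neg] at key
  exact neg_le_neg_iff.1 key

/-- **Cluster Markov property for `φ_{w,q}` (vdBHK Lemma 2.3/2.4), sum form**: on `{s ↮ t}`, given the edge cluster `C_s`, an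
event of the cluster of `t` has conditional probability `φ_{G − B(C_s)}(C_t ∈ 𝒬)`, where `B(C) = barOf {s} C` is the set of pairs
meeting `{s} ∪ V(C)`:  `E[Φ(C_s)·1{C_t ∈ 𝒬}; s↮t] = E[Φ(C_s)·φ_{delW w (B(C_s))}(C_t ∈ 𝒬); s↮t]`.
[cite: VandenbergHaggstromKahn2005, §2.1 Lemma 2.3, Lemma 2.4 (p. 10)] -/
theorem markov_rcE (w : Sym2 V → unitInterval) {q : ℝ} (hq : 0 < q) (s t : V) (Φ : Set (Sym2 V) → ℝ) (𝒬 : Set (Set V)) :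
    rcE w q (fun ω => Φ (openEdgeCluster ω s) * ind (clusterIn t 𝒬) ω * ind (sepEv s t) ω) =
      rcE w q (fun ω => Φ (openEdgeCluster ω s) *
        (rcMeasureW (delW w (barOf {s} (openEdgeCluster ω s))) q ∅).real (clusterIn t 𝒬) * ind (sepEv s t) ω) := by
  have hD : ∀ ω : BondConfig V, ω ∈ sepEv s t ↔
      ∀ a ∈ ({s} : Set V), ∀ b ∈ ({t} : Set V), ¬ (openGraph ω).Reachable a b := by
    intro ω; simp only [mem_sepEv_iff, mem_singleton_iff, forall_eq]
  have key := rc_set_sum_cond_cluster w hq {s} {t} (fun C C' => Φ C * ind 𝒬 {a | a = t ∨ ∃ e ∈ C', a ∈ e}) hD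
  have hspan : ∀ η : BondConfig V, ind 𝒬 {a | a = t ∨ ∃ e ∈ setCl η {t}, a ∈ e} = ind (clusterIn t 𝒬) η := by
    intro η; rw [setCl_singleton, ind_span_openEdgeCluster]
  have inner : ∀ C : Set (Sym2 V),
      ∑ η : BondConfig V, rcMass (delW w (barOf {s} C)) q η * (Φ C * ind 𝒬 {a | a = t ∨ ∃ e ∈ setCl η {t}, a ∈ e}) =
        Φ C * (rcMeasureW (delW w (barOf {s} C)) q ∅).real (clusterIn t 𝒬) := by
    intro C
    rw [rcMeasureW_real_eq_sum_rcMass _ hq, Finset.mul_sum]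
    exact Finset.sum_congr rfl fun η _ => by rw [hspan η]; ring
  calc rcE w q (fun ω => Φ (openEdgeCluster ω s) * ind (clusterIn t 𝒬) ω * ind (sepEv s t) ω)
      = ∑ ω : BondConfig V, rcMass w q ω *
          (Φ (setCl ω {s}) * ind 𝒬 {a | a = t ∨ ∃ e ∈ setCl ω {t}, a ∈ e} * ind (sepEv s t) ω) := by
        unfold rcE
        exact Finset.sum_congr rfl fun ω _ => by rw [hspan ω, setCl_singleton]
    _ = ∑ ω : BondConfig V, rcMass w q ω *
          ((∑ η : BondConfig V, rcMass (delW w (barOf {s} (setCl ω {s}))) q η *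
            (Φ (setCl ω {s}) * ind 𝒬 {a | a = t ∨ ∃ e ∈ setCl η {t}, a ∈ e})) * ind (sepEv s t) ω) := key
    _ = _ := by
        unfold rcE
        exact Finset.sum_congr rfl fun ω _ => by rw [inner, setCl_singleton]

/-! ### Monotonicity of the world quantities in the cluster (comparison in `𝐩`, `q ≥ 1`) -/

/-- `C ↦ φ_{G − B(C)}(a ↔ b)` is decreasing in the cluster `C` for `q ≥ 1` (more deleted pairs, fewer connections).
[cite: Grimmett2006, Thm. (3.21) (p. 43)] [cite: VandenbergHaggstromKahn2005, §2.1 proof of Lemma 2.7, display (16) (p. 12)] -/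
theorem antitone_real_openConn_delW (w : Sym2 V → unitInterval) {q : ℝ} (hq : 1 ≤ q) (s a b : V) :
    Antitone fun C : Set (Sym2 V) => (rcMeasureW (delW w (barOf {s} C)) q ∅).real (openConn a b) :=
  fun _ _ hCC' => rcMeasureW_real_mono_weights (fun e => delW_anti w (barOf_mono {s} hCC') e) hq ∅ (isUpperSet_openConn a b)

/-- `C ↦ φ_{G − B(C)}(a ↮ b)` is increasing in the cluster `C` for `q ≥ 1`. [cite: Grimmett2006, Thm. (3.21) (p. 43)] -/
theorem monotone_real_sepEv_delW (w : Sym2 V → unitInterval) {q : ℝ} (hq : 1 ≤ q) (s a b : V) :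
    Monotone fun C : Set (Sym2 V) => (rcMeasureW (delW w (barOf {s} C)) q ∅).real (sepEv a b) := by
  intro C C' hCC'
  have hq0 : 0 < q := one_pos.trans_le hq
  haveI := isProbabilityMeasure_rcMeasureW (delW w (barOf {s} C)) hq0 (∅ : Set V)
  haveI := isProbabilityMeasure_rcMeasureW (delW w (barOf {s} C')) hq0 (∅ : Set V)
  have h := antitone_real_openConn_delW w hq s a b hCC'
  dsimp only at h ⊢
  rw [sepEv_eq_compl_openConn, probReal_compl_eq_one_sub MeasurableSet.of_discrete,
    probReal_compl_eq_one_sub MeasurableSet.of_discrete]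
  linarith

end FK

end Summit.CriticalPhenomena.PercolationContinuityZ3.Theorems

end
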